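import Summits.MatrixMultiplication.MatrixMultiplication.Theorems.SoloInformedSupportDoor
import Literature.Computability.AlgebraicComplexity.BorderRankKronecker
import Literature.Computability.AlgebraicComplexity.SchoenhageTau

/-!
# The s-rank door, certificate form: one finite re-weighting of minimal border rank gives `ω = 2`

Solo deliverable (informed mode), sequel to `SoloInformedSupportDoor`.  The door there is an
asymptotic hypothesis (`R_s(T_cw,2^{⊗N}) = O(3^{(1+ε)N})`).  Here it is brought down to a SINGLE
FINITE OBJECT: a level `n ≥ 1`, a tensor `T'` with the same support as `T_cw,q^{⊗n}` (a re-weighting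
of its `6^n`-point support... for `q = 2`), and a bound `r` on its BORDER RANK.  Then

* `supportRank_growth_of_sameSupport_certificate`: `R_s(T_cw,q^{⊗N}) = O((r^{1/n})^{(1+ε)N})` for
  every `ε > 0` (BCS Lemma 15.27 for `T'`, then `R_s((T_cw^{⊗n})^{⊗k}) ≤ R(T'^{⊗k})`, the power
  and sum re-indexings `T^{⊗(kn)} ≃ (T^{⊗n})^{⊗k}`, `T^{⊗(a+b)} ≃ T^{⊗a} ⊗ T^{⊗b}` being
  support-faithful);
* `omega_le_of_sameSupport_certificate`: `ω ≤ (3 log_q(4 r^{3/n}/27) − 2)/2`;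
* `matrixMultiplication_of_minimalBorderRank_certificate`: if for some `n ≥ 1` the support of
  `T_cw,2^{⊗n}` carries a tensor of border rank `≤ 3^n` — i.e. of MINIMAL border rank, `3^n` being
  the flattening lower bound for every nowhere-zero re-weighting — then `ω = 2`;
* `omega_lt_of_levelTwo_certificate`: at level `n = 2` (support of `T_cw,2^{⊗2} ≅ perm₃`, 36
  points), a re-weighting of border rank `≤ 10` would already give `ω < 2.36 < 2.3713…`; the flat
  weighting has border rank `16` (Conner–Huang–Landsberg 2022), the minimum over re-weightings is
  unknown.

## References
* H. Cohn, C. Umans, *Fast matrix multiplication using coherent configurations*, SODA 2013,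
  arXiv:1207.6528, §3 (s-rank, border s-rank), p. 8. [CohnUmans2013]
* P. Bürgisser, M. Clausen, M. A. Shokrollahi, *Algebraic Complexity Theory* (1997), Lemma 15.27,
  Thm. 15.41. [BurgisserClausenShokrollahi1997]
* A. Conner, F. Gesmundo, J. M. Landsberg, E. Ventura, *Rank and border rank of Kronecker powers
  of tensors and Strassen's laser method*, comput. complexity 31 (2022).
  [ConnerGesmundoLandsbergVentura2022]
-/

noncomputable section

open scoped BigOperators
open Filter Asymptotics Finset

namespace Summit.MatrixMultiplication.MatrixMultiplication.Theorems.SupportRankDoor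

open Literature.Computability.AlgebraicComplexity

universe u

section Reindex

variable {K : Type u} [Field K] {ι κ μ : Type}

/-- Power of a power, as an identity of tensors: `T^{⊗(N n)} = (T^{⊗n})^{⊗N}` re-indexed along
`finProdFinEquiv : Fin N × Fin n ≃ Fin (N n)`.
[cite: BurgisserClausenShokrollahi1997, §15.6 (p. 372)] -/
theorem kroneckerPow_mul_eq (t : ι → κ → μ → K) (N n : ℕ) :
    kroneckerPow t (N * n) = fun a b c => kroneckerPow (kroneckerPow t n) N
      (fun i j => a (finProdFinEquiv (i, j))) (fun i j => b (finProdFinEquiv (i, j)))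
      (fun i j => c (finProdFinEquiv (i, j))) := by
  funext a b c
  simp only [kroneckerPow_apply]
  rw [← Fintype.prod_prod_type']
  refine (Fintype.prod_equiv finProdFinEquiv _ _ fun p => ?_).symm
  rfl

/-- Sum of exponents, as an identity of tensors: `T^{⊗(m+n)} = T^{⊗m} ⊗ T^{⊗n}` re-indexed along
`Fin m ⊕ Fin n ≃ Fin (m+n)`. [cite: BurgisserClausenShokrollahi1997, §15.6 (p. 372)] -/
theorem kroneckerPow_add_eq (t : ι → κ → μ → K) (m n : ℕ) :
    kroneckerPow t (m + n) = fun a b c => kroneckerTensor (kroneckerPow t m) (kroneckerPow t n)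
      (fun i => a (Fin.castAdd n i), fun j => a (Fin.natAdd m j))
      (fun i => b (Fin.castAdd n i), fun j => b (Fin.natAdd m j))
      (fun i => c (Fin.castAdd n i), fun j => c (Fin.natAdd m j)) := by
  funext a b c
  simp only [kroneckerPow_apply, kroneckerTensor_apply]
  exact Fin.prod_univ_add _

variable [Fintype ι] [Fintype κ] [Fintype μ]

/-- `R_s(T^{⊗(N n)}) ≤ R_s((T^{⊗n})^{⊗N})`: re-indexing is support-faithful.
[cite: CohnUmans2013, §3 (after Def. 1)] -/
theorem supportRank_kroneckerPow_mul_le (t : ι → κ → μ → K) (N n : ℕ) :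
    supportRank (kroneckerPow t (N * n)) ≤ supportRank (kroneckerPow (kroneckerPow t n) N) := by
  rw [kroneckerPow_mul_eq]
  exact supportRank_precomp_le _ _ _ _

/-- `R_s(T^{⊗(m+n)}) ≤ R_s(T^{⊗m}) · R_s(T^{⊗n})`: s-rank is sub-multiplicative along powers.
[cite: CohnUmans2013, §3 (after Def. 1)] -/
theorem supportRank_kroneckerPow_add_le (t : ι → κ → μ → K) (m n : ℕ) :
    supportRank (kroneckerPow t (m + n)) ≤
      supportRank (kroneckerPow t m) * supportRank (kroneckerPow t n) := by
  rw [kroneckerPow_add_eq]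
  exact (supportRank_precomp_le _ _ _ _).trans (supportRank_kroneckerTensor_le _ _)

end Reindex

/-! ## From one finite certificate to the growth hypothesis of the door -/

/-- **Certificate ⇒ growth.** If `T'` has the support of `T_cw,q^{⊗n}` (`n ≥ 1`) and border rank
`≤ r` (`r ≥ 2`), then `R_s(T_cw,q^{⊗N}) = O((r^{1/n})^{(1+ε)N})` for every `ε > 0`: by BCS Lemma
15.27 `R(T'^{⊗k}) = O(r^{(1+ε)k})`, and
`R_s(T_cw,q^{⊗(kn+j)}) ≤ R_s((T_cw,q^{⊗n})^{⊗k}) · R_s(T_cw,q^{⊗j}) ≤ R(T'^{⊗k}) · R_s(T_cw,q^{⊗j})`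
(`j < n`). [cite: BurgisserClausenShokrollahi1997, Lemma 15.27] -/
theorem supportRank_growth_of_sameSupport_certificate {q n r : ℕ} (hn : 1 ≤ n) (hr : 2 ≤ r)
    {T' : (Fin n → Fin (q + 1)) → (Fin n → Fin (q + 1)) → (Fin n → Fin (q + 1)) → ℂ}
    (hT' : SameSupport (kroneckerPow (cwTensor ℂ q) n) T') (hbR : algBorderRank T' ≤ r) :
    ∀ ε : ℝ, 0 < ε →
      (fun N : ℕ => (supportRank (kroneckerPow (cwTensor ℂ q) N) : ℝ)) =O[atTop]
        fun N : ℕ => ((r : ℝ) ^ ((1 : ℝ) / n)) ^ ((1 + ε) * N) := by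
  intro ε hε
  set T := cwTensor ℂ q with hT
  have hr1 : (1 : ℝ) ≤ r := by exact_mod_cast (show 1 ≤ r by omega)
  have hr0 : (0 : ℝ) < r := by positivity
  have hn0 : (n : ℝ) ≠ 0 := by exact_mod_cast (show n ≠ 0 by omega)
  obtain ⟨C, hC, hb⟩ :=
    bound_of_isBigO_nat_atTop (isBigO_tensorRank_kroneckerPow_of_algBorderRank_le hbR hr hε)
  have hrank : ∀ k : ℕ, (tensorRank (kroneckerPow T' k) : ℝ) ≤ C * (r : ℝ) ^ ((1 + ε) * k) := by
    intro k
    have hg : (r : ℝ) ^ ((1 + ε) * k) ≠ 0 := (Real.rpow_pos_of_pos hr0 _).ne'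
    have := hb hg
    rwa [Real.norm_of_nonneg (Nat.cast_nonneg _),
      Real.norm_of_nonneg (Real.rpow_pos_of_pos hr0 _).le] at this
  -- the finitely many remainders `T^{⊗j}`, `j < n`
  set M : ℕ := ∑ j ∈ Finset.range n, supportRank (kroneckerPow T j) with hM
  have hMj : ∀ j, j < n → supportRank (kroneckerPow T j) ≤ M := fun j hj =>
    Finset.single_le_sum (f := fun j => supportRank (kroneckerPow T j)) (fun _ _ => Nat.zero_le _)
      (Finset.mem_range.2 hj)
  refine IsBigO.of_bound (C * M) (Eventually.of_forall fun N => ?_)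
  rw [Real.norm_of_nonneg (Nat.cast_nonneg _), Real.norm_of_nonneg (by positivity)]
  -- `N = n k + j`
  set k := N / n with hk
  set j := N % n with hj
  have hN : n * k + j = N := Nat.div_add_mod N n
  have hjn : j < n := Nat.mod_lt N (by omega)
  -- `R_s(T^{⊗N}) ≤ R(T'^{⊗k}) · M`
  have h1 : supportRank (kroneckerPow T N) ≤ tensorRank (kroneckerPow T' k) * M := by
    rw [← hN]
    refine (supportRank_kroneckerPow_add_le T (n * k) j).trans ?_
    refine Nat.mul_le_mul ?_ (hMj j hjn)
    rw [Nat.mul_comm]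
    exact (supportRank_kroneckerPow_mul_le T k n).trans
      (supportRank_kroneckerPow_le_of_sameSupport hT' k)
  have h2 : (supportRank (kroneckerPow T N) : ℝ) ≤ C * (r : ℝ) ^ ((1 + ε) * k) * M := by
    calc (supportRank (kroneckerPow T N) : ℝ) ≤ (tensorRank (kroneckerPow T' k) : ℝ) * M := by
          exact_mod_cast h1
      _ ≤ C * (r : ℝ) ^ ((1 + ε) * k) * M :=
          mul_le_mul_of_nonneg_right (hrank k) (Nat.cast_nonneg _)
  -- `r^{(1+ε)k} ≤ (r^{1/n})^{(1+ε)N}` since `n k ≤ N`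
  have h3 : (r : ℝ) ^ ((1 + ε) * k) ≤ ((r : ℝ) ^ ((1 : ℝ) / n)) ^ ((1 + ε) * N) := by
    rw [← Real.rpow_mul hr0.le]
    refine Real.rpow_le_rpow_of_exponent_le hr1 ?_
    have hkN : (n : ℝ) * k ≤ N := by exact_mod_cast (show n * k ≤ N by omega)
    have hnpos : (0 : ℝ) < n := by exact_mod_cast (show 0 < n by omega)
    rw [one_div, mul_comm (n : ℝ)⁻¹, mul_assoc]
    refine mul_le_mul_of_nonneg_left ?_ (by linarith)
    rw [← div_eq_mul_inv, le_div_iff₀ hnpos]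
    linarith
  calc (supportRank (kroneckerPow T N) : ℝ) ≤ C * (r : ℝ) ^ ((1 + ε) * k) * M := h2
    _ ≤ C * ((r : ℝ) ^ ((1 : ℝ) / n)) ^ ((1 + ε) * N) * M := by gcongr
    _ = C * M * ((r : ℝ) ^ ((1 : ℝ) / n)) ^ ((1 + ε) * N) := by ring

/-- **The s-rank door, certificate form (graded).** A re-weighting `T'` of the support of
`T_cw,q^{⊗n}` with border rank `≤ r` gives `ω ≤ (3 log_q(4 r^{3/n}/27) − 2)/2`.
[cite: CohnUmans2013, Thm. 6 and §3 p. 8] -/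
theorem omega_le_of_sameSupport_certificate {q n r : ℕ} (hq : 2 ≤ q) (hn : 1 ≤ n) (hr : 2 ≤ r)
    {T' : (Fin n → Fin (q + 1)) → (Fin n → Fin (q + 1)) → (Fin n → Fin (q + 1)) → ℂ}
    (hT' : SameSupport (kroneckerPow (cwTensor ℂ q) n) T') (hbR : algBorderRank T' ≤ r) :
    omega ℂ ≤ (3 * Real.logb q (4 * (r : ℝ) ^ ((3 : ℝ) / n) / 27) - 2) / 2 := by
  have hr0 : (0 : ℝ) < r := by exact_mod_cast (show 0 < r by omega)
  have hρ : (0 : ℝ) < (r : ℝ) ^ ((1 : ℝ) / n) := Real.rpow_pos_of_pos hr0 _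
  have h := omega_le_of_supportRank_cw_growth hq hρ
    (supportRank_growth_of_sameSupport_certificate hn hr hT' hbR)
  have h3 : ((r : ℝ) ^ ((1 : ℝ) / n)) ^ 3 = (r : ℝ) ^ ((3 : ℝ) / n) := by
    rw [← Real.rpow_natCast, ← Real.rpow_mul hr0.le]
    congr 1
    push_cast
    ring
  rwa [h3] at h

/-- The same from a RANK certificate (`bR ≤ R`). [cite: CohnUmans2013, Thm. 6 and §3 p. 8] -/
theorem omega_le_of_sameSupport_rank_certificate {q n r : ℕ} (hq : 2 ≤ q) (hn : 1 ≤ n) (hr : 2 ≤ r)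
    {T' : (Fin n → Fin (q + 1)) → (Fin n → Fin (q + 1)) → (Fin n → Fin (q + 1)) → ℂ}
    (hT' : SameSupport (kroneckerPow (cwTensor ℂ q) n) T') (hR : tensorRank T' ≤ r) :
    omega ℂ ≤ (3 * Real.logb q (4 * (r : ℝ) ^ ((3 : ℝ) / n) / 27) - 2) / 2 :=
  omega_le_of_sameSupport_certificate hq hn hr hT' ((algBorderRank_le_tensorRank T').trans hR)

/-- **One minimal-border-rank re-weighting gives `ω = 2`.** If for some `n ≥ 1` the support of
`T_cw,2^{⊗n}` carries a tensor `T'` with `bR(T') ≤ 3^n` (the flattening lower bound — so `T'` has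
minimal border rank), then `ω = 2`. [cite: CohnUmans2013, Thm. 6 and §3 p. 8] -/
theorem matrixMultiplication_of_minimalBorderRank_certificate {n : ℕ} (hn : 1 ≤ n)
    {T' : (Fin n → Fin 3) → (Fin n → Fin 3) → (Fin n → Fin 3) → ℂ}
    (hT' : SameSupport (kroneckerPow (cwTensor ℂ 2) n) T') (hbR : algBorderRank T' ≤ 3 ^ n) :
    _root_.MatrixMultiplication := by
  have hr : 2 ≤ 3 ^ n := le_trans (by norm_num) (Nat.pow_le_pow_right (by norm_num) hn)
  have hg := supportRank_growth_of_sameSupport_certificate hn hr hT' hbR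
  have hn0 : (n : ℝ) ≠ 0 := by exact_mod_cast (show n ≠ 0 by omega)
  have h3 : (((3 ^ n : ℕ) : ℝ) ^ ((1 : ℝ) / n)) = 3 := by
    push_cast
    rw [← Real.rpow_natCast, ← Real.rpow_mul (by norm_num), mul_one_div_cancel hn0, Real.rpow_one]
  rw [h3] at hg
  exact matrixMultiplication_of_supportRank_cwTensor_two_growth hg

/-- The numerical inequality `log₂(4 · 10^{3/2}/27) < 2.24`, via squaring:
`(4·10^{3/2}/27)² = 16000/729 = 21.94… < 2^{4.48} = 22.3…`, certified by
`(16000/729)^25 < 2^112`. -/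
theorem logb_two_levelTwo_bound_lt : Real.logb 2 (4 * (10 : ℝ) ^ ((3 : ℝ) / 2) / 27) < 2.24 := by
  have h10 : (10 : ℝ) ^ ((3 : ℝ) / 2) = 10 * √10 := by
    rw [show (3 : ℝ) / 2 = 1 + 1 / 2 by norm_num, Real.rpow_add (by norm_num), Real.rpow_one,
      ← Real.sqrt_eq_rpow]
  have hx : (0 : ℝ) < 4 * (10 : ℝ) ^ ((3 : ℝ) / 2) / 27 := by positivity
  have hsq : (4 * (10 : ℝ) ^ ((3 : ℝ) / 2) / 27) ^ 2 = 16000 / 729 := by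
    rw [h10]; nlinarith [Real.sq_sqrt (show (0 : ℝ) ≤ 10 by norm_num)]
  have h2 : Real.logb 2 (16000 / 729 : ℝ) < 4.48 := by
    rw [Real.logb_lt_iff_lt_rpow one_lt_two (by norm_num)]
    have h : ((16000 : ℝ) / 729) ^ 25 < ((2 : ℝ) ^ (4.48 : ℝ)) ^ 25 := by
      rw [← Real.rpow_natCast ((2 : ℝ) ^ (4.48 : ℝ)), ← Real.rpow_mul (by norm_num)]
      norm_num
    exact lt_of_pow_lt_pow_left₀ 25 (by positivity) h
  have hlog : Real.logb 2 (4 * (10 : ℝ) ^ ((3 : ℝ) / 2) / 27) =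
      Real.logb 2 (16000 / 729 : ℝ) / 2 := by
    rw [← hsq, Real.logb_pow]; ring
  rw [hlog]; linarith

/-- **Level two, in numbers.** A re-weighting of the 36-point support of `T_cw,2^{⊗2}` (`≅ perm₃`)
with border rank `≤ 10` would give `ω < 2.36 < 2.3713…` (the flat weighting has border rank `16`;
the flattening lower bound, valid for every re-weighting, is `9`, and `9` would give `ω = 2`).
[cite: AlmanDuanVassilevskaWilliamsXuXuZhou2025, Thm. 1.1] -/
theorem omega_lt_of_levelTwo_certificate
    {T' : (Fin 2 → Fin 3) → (Fin 2 → Fin 3) → (Fin 2 → Fin 3) → ℂ}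
    (hT' : SameSupport (kroneckerPow (cwTensor ℂ 2) 2) T') (hbR : algBorderRank T' ≤ 10) :
    omega ℂ < 2.36 := by
  have h := omega_le_of_sameSupport_certificate (q := 2) (n := 2) (r := 10) le_rfl (by norm_num)
    (by norm_num) hT' hbR
  push_cast at h
  have hb := logb_two_levelTwo_bound_lt
  have h' : omega ℂ ≤ (3 * Real.logb 2 (4 * (10 : ℝ) ^ ((3 : ℝ) / 2) / 27) - 2) / 2 := by
    convert h using 4
  linarith

end Summit.MatrixMultiplication.MatrixMultiplication.Theorems.SupportRankDoor

end
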